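import Summits.AtomisticToContinuum.FouriersLaw.Theorems.HiddenChargeMazurDressedChargeMainReductionAux3
import Summits.AtomisticToContinuum.FouriersLaw.Theorems.HiddenChargeMazurDressedChargeMainReductionAux4
import Summits.AtomisticToContinuum.FouriersLaw.Theorems.HiddenChargeMazurDressedChargeMainReductionAux6
import Summits.AtomisticToContinuum.FouriersLaw.Theorems.HiddenChargeMazurDressedChargeStubSeedLink

/-!
# Main reduction for stub S1 of crux `DressedCharge` — helper 7: base change to `ℂ`, split and component
# equations, the cases `n₀ = 0` and `n₀ ≥ 2`

Crux stmt-AtomisticToContinuum-13509 (`HiddenChargeMazur.DressedCharge`), line `birth`, stub G (lead).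
Base change of the pieces of the linearised operator of `pinnedChain` to `ℂ` in the EXACT syntactic form
of the registered stubs C–F, and the rigidity theorem: a momentum-even real solution `u` of the
linearised lattice equation `L (L u) + 𝒲 u = 0` vanishes — by the total-degree filtration (lowest
component `u_{n₀}`: `n₀ = 0` is killed by `ω₂ ≠ 0`, `n₀ ≥ 2` by stubs C + D (harmonic rigidity), `n₀ = 1`
by stubs E + F (the seed obstruction) through the structure theorem of helper 5).
No definitions, no notation.
-/

noncomputable section

namespace Summit.AtomisticToContinuum.FouriersLaw.Theorems.DressedCharge

open MvPolynomial

/-! ## Base change of the operator pieces (exact complex forms) -/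

/-- Base change of the harmonic Liouville derivation, complex form with `C ((ω₂ : ℂ) + 2)`. -/
theorem mapC_liouville1 (ω₂ : ℝ) (f : MvPolynomial (ℤ ⊕ ℤ) ℝ) :
    MvPolynomial.map Complex.ofRealHom
      (MvPolynomial.mkDerivation ℝ (Sum.elim (fun i : ℤ => (X (Sum.inr i) : MvPolynomial (ℤ ⊕ ℤ) ℝ))
        (fun i : ℤ => -(C (ω₂ + 2) * X (Sum.inl i)) + X (Sum.inl (i + 1)) + X (Sum.inl (i - 1)))) f) =
    (MvPolynomial.mkDerivation ℂ (Sum.elim (fun i : ℤ => (MvPolynomial.X (Sum.inr i) : MvPolynomial (ℤ ⊕ ℤ) ℂ)) (fun i : ℤ => -(MvPolynomial.C ((ω₂ : ℂ) + 2) * MvPolynomial.X (Sum.inl i)) + MvPolynomial.X (Sum.inl (i + 1)) + MvPolynomial.X (Sum.inl (i - 1))))) (MvPolynomial.map Complex.ofRealHom f) := by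
  apply map_mkDerivation
  intro v
  rcases v with x | x
  · simp
  · simp only [Sum.elim_inr, map_add, map_neg, map_mul, map_C, map_X, Complex.ofRealHom_eq_coe,
      Complex.ofReal_ofNat]

/-- Base change of the cubic force derivation, complex form. -/
theorem mapC_liouville3 (lam β : ℝ) (f : MvPolynomial (ℤ ⊕ ℤ) ℝ) :
    MvPolynomial.map Complex.ofRealHom
      (MvPolynomial.mkDerivation ℝ (Sum.elim (fun _ : ℤ => (0 : MvPolynomial (ℤ ⊕ ℤ) ℝ))
        (fun i : ℤ => -(C lam * X (Sum.inl i) ^ 3) + C β * (X (Sum.inl (i + 1)) - X (Sum.inl i)) ^ 3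
          - C β * (X (Sum.inl i) - X (Sum.inl (i - 1))) ^ 3)) f) =
    (MvPolynomial.mkDerivation ℂ (Sum.elim (fun _ : ℤ => (0 : MvPolynomial (ℤ ⊕ ℤ) ℂ)) (fun i : ℤ => -(MvPolynomial.C (lam : ℂ) * MvPolynomial.X (Sum.inl i) ^ 3) + MvPolynomial.C (β : ℂ) * (MvPolynomial.X (Sum.inl (i + 1)) - MvPolynomial.X (Sum.inl i)) ^ 3 - MvPolynomial.C (β : ℂ) * (MvPolynomial.X (Sum.inl i) - MvPolynomial.X (Sum.inl (i - 1))) ^ 3))) (MvPolynomial.map Complex.ofRealHom f) := by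
  apply map_mkDerivation
  intro v
  rcases v with x | x
  · simp
  · simp only [Sum.elim_inr, map_add, map_sub, map_neg, map_mul, map_pow, map_C, map_X, Complex.ofRealHom_eq_coe]

/-- An iterated plane-wave derivative of `0` is `0`. -/
theorem foldr_planeWave_zero (l : List (ℂ × ℂ)) :
    l.foldr (fun (Pj : ℂ × ℂ) (acc : MvPolynomial (ℤ ⊕ ℤ) ℂ) => MvPolynomial.mkDerivation ℂ
      (Sum.elim (fun x : ℤ => (MvPolynomial.C (Pj.1 ^ x) : MvPolynomial (ℤ ⊕ ℤ) ℂ))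
        (fun x : ℤ => MvPolynomial.C (Pj.2 * Pj.1 ^ x))) acc) 0 = 0 := by
  induction l with
  | nil => simp only [List.foldr_nil]
  | cons P l ih => simp only [List.foldr_cons, ih, map_zero]

/-! ## Splitting of the full Liouville derivation over `ℝ` -/

/-- `L = L₁ + L₃` for the pinned anharmonic chain (real coefficients). -/
theorem liouville_split (ω₂ lam β : ℝ) (f : MvPolynomial (ℤ ⊕ ℤ) ℝ) :
    (MvPolynomial.mkDerivation ℝ (Sum.elim (fun i : ℤ => (MvPolynomial.X (Sum.inr i) : MvPolynomial (ℤ ⊕ ℤ) ℝ)) (fun i : ℤ => -(MvPolynomial.C ω₂ * MvPolynomial.X (Sum.inl i) + MvPolynomial.C lam * MvPolynomial.X (Sum.inl i) ^ 3) + ((MvPolynomial.X (Sum.inl (i + 1)) - MvPolynomial.X (Sum.inl i)) + MvPolynomial.C β * (MvPolynomial.X (Sum.inl (i + 1)) - MvPolynomial.X (Sum.inl i)) ^ 3) - ((MvPolynomial.X (Sum.inl i) - MvPolynomial.X (Sum.inl (i - 1))) + MvPolynomial.C β * (MvPolynomial.X (Sum.inl i) - MvPolynomial.X (Sum.inl (i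 - 1))) ^ 3)))) f =
    MvPolynomial.mkDerivation ℝ (Sum.elim (fun i : ℤ => (X (Sum.inr i) : MvPolynomial (ℤ ⊕ ℤ) ℝ))
        (fun i : ℤ => -(C (ω₂ + 2) * X (Sum.inl i)) + X (Sum.inl (i + 1)) + X (Sum.inl (i - 1)))) f +
      MvPolynomial.mkDerivation ℝ (Sum.elim (fun _ : ℤ => (0 : MvPolynomial (ℤ ⊕ ℤ) ℝ))
        (fun i : ℤ => -(C lam * X (Sum.inl i) ^ 3) + C β * (X (Sum.inl (i + 1)) - X (Sum.inl i)) ^ 3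
          - C β * (X (Sum.inl i) - X (Sum.inl (i - 1))) ^ 3)) f := by
  rw [← Derivation.add_apply]
  congr 1
  apply MvPolynomial.derivation_ext
  intro v
  rw [Derivation.add_apply, mkDerivation_X, mkDerivation_X, mkDerivation_X]
  rcases v with x | x
  · simp
  · simp only [Sum.elim_inr, map_add, map_ofNat]
    ring


/-! ## The rigidity theorem `u = 0` -/

/-- **The split equation.** The linearised equation of `pinnedChain` in the filtered form
`T₀ u + T₂ u + T₄ u = 0` (`T₀ = L₁L₁ + 𝒲₀`, `T₂ = L₁L₃ + L₃L₁ + 𝒲₂`, `T₄ = L₃L₃`). -/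
theorem linearised_split (ω₂ lam β : ℝ) (u : MvPolynomial (ℤ ⊕ ℤ) ℝ)
    (hlin : (MvPolynomial.mkDerivation ℝ (Sum.elim (fun i : ℤ => (MvPolynomial.X (Sum.inr i) : MvPolynomial (ℤ ⊕ ℤ) ℝ)) (fun i : ℤ => -(MvPolynomial.C ω₂ * MvPolynomial.X (Sum.inl i) + MvPolynomial.C lam * MvPolynomial.X (Sum.inl i) ^ 3) + ((MvPolynomial.X (Sum.inl (i + 1)) - MvPolynomial.X (Sum.inl i)) + MvPolynomial.C β * (MvPolynomial.X (Sum.inl (i + 1)) - MvPolynomial.X (Sum.inl i)) ^ 3) - ((MvPolynomial.X (Sum.inl i) - MvPolynomial.X (Sum.inl (i - 1))) + MvPolynomial.C β * (MvPolynomial.X (Sum.inl i) - MvPolynomial.X (Sum.inl (i - 1))) ^ 3)))) ((MvPolynomial.mkDerivation ℝ (Sum.elim (fun i : ℤ => (MvPolynomial.X (Sum.inr i) : MvPolynomial (ℤ ⊕ ℤ) ℝ)) (fun i : ℤ => -(MvPolynomial.C ω₂ * MvPolynomial.X (Sum.inl i) + MvPolynomial.C lam * MvPolynomial.X (Sum.inl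 i) ^ 3) + ((MvPolynomial.X (Sum.inl (i + 1)) - MvPolynomial.X (Sum.inl i)) + MvPolynomial.C β * (MvPolynomial.X (Sum.inl (i + 1)) - MvPolynomial.X (Sum.inl i)) ^ 3) - ((MvPolynomial.X (Sum.inl i) - MvPolynomial.X (Sum.inl (i - 1))) + MvPolynomial.C β * (MvPolynomial.X (Sum.inl i) - MvPolynomial.X (Sum.inl (i - 1))) ^ 3)))) u) + ((MvPolynomial.C ω₂ + MvPolynomial.C (3 * lam) * MvPolynomial.X (Sum.inl 0) ^ 2 + (1 + MvPolynomial.C (3 * β) * (MvPolynomial.X (Sum.inl 1) - MvPolynomial.X (Sum.inl 0)) ^ 2) + (1 + MvPolynomial.C (3 * β) * (MvPolynomial.X (Sum.inl 0) - MvPolynomial.X (Sum.inl (-1))) ^ 2)) * u + -(1 + MvPolynomial.C (3 * β) * (MvPolynomial.X (Sum.inl 1) - MvPolynomial.X (Sum.inl 0)) ^ 2) * MvPolynomial.rename (Sum.map (fun i : ℤ => i + 1) (fun i : ℤ => i + 1)) (u) + -(1 + MvPolynomial.C (3 * β) * (MvPolynomial.X (Sum.inl 0) - MvPolynomial.X (Sum.inl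 (-1))) ^ 2) * MvPolynomial.rename (Sum.map (fun i : ℤ => i + -1) (fun i : ℤ => i + -1)) (u)) = 0) :
    ((MvPolynomial.mkDerivation ℝ (Sum.elim (fun i : ℤ => (X (Sum.inr i) : MvPolynomial (ℤ ⊕ ℤ) ℝ)) (fun i : ℤ => -(C (ω₂ + 2) * X (Sum.inl i)) + X (Sum.inl (i + 1)) + X (Sum.inl (i - 1))))) ((MvPolynomial.mkDerivation ℝ (Sum.elim (fun i : ℤ => (X (Sum.inr i) : MvPolynomial (ℤ ⊕ ℤ) ℝ)) (fun i : ℤ => -(C (ω₂ + 2) * X (Sum.inl i)) + X (Sum.inl (i + 1)) + X (Sum.inl (i - 1))))) (u)) + (C (ω₂ + 2) * (u) - rename (Sum.map (fun i : ℤ => i + 1) (fun i : ℤ => i + 1)) (u) - rename (Sum.map (fun i : ℤ => i + -1) (fun i : ℤ => i + -1)) (u))) + ((MvPolynomial.mkDerivation ℝ (Sum.elim (fun i : ℤ => (X (Sum.inr i) : MvPolynomial (ℤ ⊕ ℤ) ℝ)) (fun i : ℤ => -(C (ω₂ + 2) * X (Sum.inl i)) + X (Sum.inl (i + 1)) + X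 (Sum.inl (i - 1))))) ((MvPolynomial.mkDerivation ℝ (Sum.elim (fun _ : ℤ => (0 : MvPolynomial (ℤ ⊕ ℤ) ℝ)) (fun i : ℤ => -(C lam * X (Sum.inl i) ^ 3) + C β * (X (Sum.inl (i + 1)) - X (Sum.inl i)) ^ 3 - C β * (X (Sum.inl i) - X (Sum.inl (i - 1))) ^ 3))) (u)) + (MvPolynomial.mkDerivation ℝ (Sum.elim (fun _ : ℤ => (0 : MvPolynomial (ℤ ⊕ ℤ) ℝ)) (fun i : ℤ => -(C lam * X (Sum.inl i) ^ 3) + C β * (X (Sum.inl (i + 1)) - X (Sum.inl i)) ^ 3 - C β * (X (Sum.inl i) - X (Sum.inl (i - 1))) ^ 3))) ((MvPolynomial.mkDerivation ℝ (Sum.elim (fun i : ℤ => (X (Sum.inr i) : MvPolynomial (ℤ ⊕ ℤ) ℝ)) (fun i : ℤ => -(C (ω₂ + 2) * X (Sum.inl i)) + X (Sum.inl (i + 1)) + X (Sum.inl (i - 1))))) (u)) + ((C (3 * lam) * X (Sum.inl 0) ^ 2 + C (3 * β) * (X (Sum.inl 1) - X (Sum.inl 0)) ^ 2 + C (3 *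 β) * (X (Sum.inl 0) - X (Sum.inl (-1))) ^ 2) * (u) - C (3 * β) * (X (Sum.inl 1) - X (Sum.inl 0)) ^ 2 * rename (Sum.map (fun i : ℤ => i + 1) (fun i : ℤ => i + 1)) (u) - C (3 * β) * (X (Sum.inl 0) - X (Sum.inl (-1))) ^ 2 * rename (Sum.map (fun i : ℤ => i + -1) (fun i : ℤ => i + -1)) (u))) + ((MvPolynomial.mkDerivation ℝ (Sum.elim (fun _ : ℤ => (0 : MvPolynomial (ℤ ⊕ ℤ) ℝ)) (fun i : ℤ => -(C lam * X (Sum.inl i) ^ 3) + C β * (X (Sum.inl (i + 1)) - X (Sum.inl i)) ^ 3 - C β * (X (Sum.inl i) - X (Sum.inl (i - 1))) ^ 3))) ((MvPolynomial.mkDerivation ℝ (Sum.elim (fun _ : ℤ => (0 : MvPolynomial (ℤ ⊕ ℤ) ℝ)) (fun i : ℤ => -(C lam * X (Sum.inl i) ^ 3) + C β * (X (Sum.inl (i + 1)) - X (Sum.inl i)) ^ 3 - C β * (X (Sum.inl i) - X (Sum.inl (i - 1))) ^ 3))) (u))) = 0 := by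
  have hB := hlin
  rw [liouville_split, liouville_split] at hB
  set L1 := (MvPolynomial.mkDerivation ℝ (Sum.elim (fun i : ℤ => (X (Sum.inr i) : MvPolynomial (ℤ ⊕ ℤ) ℝ))
    (fun i : ℤ => -(C (ω₂ + 2) * X (Sum.inl i)) + X (Sum.inl (i + 1)) + X (Sum.inl (i - 1))))) with hL1
  set L3 := (MvPolynomial.mkDerivation ℝ (Sum.elim (fun _ : ℤ => (0 : MvPolynomial (ℤ ⊕ ℤ) ℝ))
    (fun i : ℤ => -(C lam * X (Sum.inl i) ^ 3) + C β * (X (Sum.inl (i + 1)) - X (Sum.inl i)) ^ 3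
      - C β * (X (Sum.inl i) - X (Sum.inl (i - 1))) ^ 3))) with hL3
  have e2 : (C (ω₂ + 2) : MvPolynomial (ℤ ⊕ ℤ) ℝ) = C ω₂ + 2 := by rw [map_add, map_ofNat]
  simp only [map_add] at hB
  rw [e2]
  linear_combination hB


/-- **Component equations.** From the split equation: the lowest nonzero homogeneous component `u_{n₀}`
solves `T₀ u_{n₀} = 0`, and if `n₀ = 1` the cubic component solves `T₀ u₃ + T₂ u₁ = 0`. -/
theorem component_equations (ω₂ lam β : ℝ) (u : MvPolynomial (ℤ ⊕ ℤ) ℝ)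
    (hsplit : ((MvPolynomial.mkDerivation ℝ (Sum.elim (fun i : ℤ => (X (Sum.inr i) : MvPolynomial (ℤ ⊕ ℤ) ℝ)) (fun i : ℤ => -(C (ω₂ + 2) * X (Sum.inl i)) + X (Sum.inl (i + 1)) + X (Sum.inl (i - 1))))) ((MvPolynomial.mkDerivation ℝ (Sum.elim (fun i : ℤ => (X (Sum.inr i) : MvPolynomial (ℤ ⊕ ℤ) ℝ)) (fun i : ℤ => -(C (ω₂ + 2) * X (Sum.inl i)) + X (Sum.inl (i + 1)) + X (Sum.inl (i - 1))))) (u)) + (C (ω₂ + 2) * (u) - rename (Sum.map (fun i : ℤ => i + 1) (fun i : ℤ => i + 1)) (u) - rename (Sum.map (fun i : ℤ => i + -1) (fun i : ℤ => i + -1)) (u))) + ((MvPolynomial.mkDerivation ℝ (Sum.elim (fun i : ℤ => (X (Sum.inr i) : MvPolynomial (ℤ ⊕ ℤ) ℝ)) (fun i : ℤ => -(C (ω₂ + 2) * X (Sum.inl i)) + X (Sum.inl (i + 1)) + X (Sum.inl (i - 1))))) ((MvPolynomial.mkDerivation ℝ (Sum.elim (fun _ : ℤ => (0 : MvPolynomial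 (ℤ ⊕ ℤ) ℝ)) (fun i : ℤ => -(C lam * X (Sum.inl i) ^ 3) + C β * (X (Sum.inl (i + 1)) - X (Sum.inl i)) ^ 3 - C β * (X (Sum.inl i) - X (Sum.inl (i - 1))) ^ 3))) (u)) + (MvPolynomial.mkDerivation ℝ (Sum.elim (fun _ : ℤ => (0 : MvPolynomial (ℤ ⊕ ℤ) ℝ)) (fun i : ℤ => -(C lam * X (Sum.inl i) ^ 3) + C β * (X (Sum.inl (i + 1)) - X (Sum.inl i)) ^ 3 - C β * (X (Sum.inl i) - X (Sum.inl (i - 1))) ^ 3))) ((MvPolynomial.mkDerivation ℝ (Sum.elim (fun i : ℤ => (X (Sum.inr i) : MvPolynomial (ℤ ⊕ ℤ) ℝ)) (fun i : ℤ => -(C (ω₂ + 2) * X (Sum.inl i)) + X (Sum.inl (i + 1)) + X (Sum.inl (i - 1))))) (u)) + ((C (3 * lam) * X (Sum.inl 0) ^ 2 + C (3 * β) * (X (Sum.inl 1) - X (Sum.inl 0)) ^ 2 + C (3 * β) * (X (Sum.inl 0) - X (Sum.inl (-1))) ^ 2) * (u) - C (3 * β) * (X (Sum.inl 1) - X (Sum.inl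 0)) ^ 2 * rename (Sum.map (fun i : ℤ => i + 1) (fun i : ℤ => i + 1)) (u) - C (3 * β) * (X (Sum.inl 0) - X (Sum.inl (-1))) ^ 2 * rename (Sum.map (fun i : ℤ => i + -1) (fun i : ℤ => i + -1)) (u))) + ((MvPolynomial.mkDerivation ℝ (Sum.elim (fun _ : ℤ => (0 : MvPolynomial (ℤ ⊕ ℤ) ℝ)) (fun i : ℤ => -(C lam * X (Sum.inl i) ^ 3) + C β * (X (Sum.inl (i + 1)) - X (Sum.inl i)) ^ 3 - C β * (X (Sum.inl i) - X (Sum.inl (i - 1))) ^ 3))) ((MvPolynomial.mkDerivation ℝ (Sum.elim (fun _ : ℤ => (0 : MvPolynomial (ℤ ⊕ ℤ) ℝ)) (fun i : ℤ => -(C lam * X (Sum.inl i) ^ 3) + C β * (X (Sum.inl (i + 1)) - X (Sum.inl i)) ^ 3 - C β * (X (Sum.inl i) - X (Sum.inl (i - 1))) ^ 3))) (u))) = 0) (n₀ : ℕ)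
    (hmin : ∀ k < n₀, homogeneousComponent k u = 0) :
    ((MvPolynomial.mkDerivation ℝ (Sum.elim (fun i : ℤ => (X (Sum.inr i) : MvPolynomial (ℤ ⊕ ℤ) ℝ)) (fun i : ℤ => -(C (ω₂ + 2) * X (Sum.inl i)) + X (Sum.inl (i + 1)) + X (Sum.inl (i - 1))))) ((MvPolynomial.mkDerivation ℝ (Sum.elim (fun i : ℤ => (X (Sum.inr i) : MvPolynomial (ℤ ⊕ ℤ) ℝ)) (fun i : ℤ => -(C (ω₂ + 2) * X (Sum.inl i)) + X (Sum.inl (i + 1)) + X (Sum.inl (i - 1))))) (homogeneousComponent n₀ u)) + (C (ω₂ + 2) * (homogeneousComponent n₀ u) - rename (Sum.map (fun i : ℤ => i + 1) (fun i : ℤ => i + 1)) (homogeneousComponent n₀ u) - rename (Sum.map (fun i : ℤ => i + -1) (fun i : ℤ => i + -1)) (homogeneousComponent n₀ u))) = 0 ∧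
    (n₀ = 1 → ((MvPolynomial.mkDerivation ℝ (Sum.elim (fun i : ℤ => (X (Sum.inr i) : MvPolynomial (ℤ ⊕ ℤ) ℝ)) (fun i : ℤ => -(C (ω₂ + 2) * X (Sum.inl i)) + X (Sum.inl (i + 1)) + X (Sum.inl (i - 1))))) ((MvPolynomial.mkDerivation ℝ (Sum.elim (fun i : ℤ => (X (Sum.inr i) : MvPolynomial (ℤ ⊕ ℤ) ℝ)) (fun i : ℤ => -(C (ω₂ + 2) * X (Sum.inl i)) + X (Sum.inl (i + 1)) + X (Sum.inl (i - 1))))) (homogeneousComponent 3 u)) + (C (ω₂ + 2) * (homogeneousComponent 3 u) - rename (Sum.map (fun i : ℤ => i + 1) (fun i : ℤ => i + 1)) (homogeneousComponent 3 u) - rename (Sum.map (fun i : ℤ => i + -1) (fun i : ℤ => i + -1)) (homogeneousComponent 3 u))) + ((MvPolynomial.mkDerivation ℝ (Sum.elim (fun i : ℤ => (X (Sum.inr i) : MvPolynomial (ℤ ⊕ ℤ) ℝ)) (fun i : ℤ => -(C (ω₂ + 2) * X (Sum.inl i)) + X (Sum.inl (i + 1)) + X (Sum.inl (i - 1)))))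 ((MvPolynomial.mkDerivation ℝ (Sum.elim (fun _ : ℤ => (0 : MvPolynomial (ℤ ⊕ ℤ) ℝ)) (fun i : ℤ => -(C lam * X (Sum.inl i) ^ 3) + C β * (X (Sum.inl (i + 1)) - X (Sum.inl i)) ^ 3 - C β * (X (Sum.inl i) - X (Sum.inl (i - 1))) ^ 3))) (homogeneousComponent 1 u)) + (MvPolynomial.mkDerivation ℝ (Sum.elim (fun _ : ℤ => (0 : MvPolynomial (ℤ ⊕ ℤ) ℝ)) (fun i : ℤ => -(C lam * X (Sum.inl i) ^ 3) + C β * (X (Sum.inl (i + 1)) - X (Sum.inl i)) ^ 3 - C β * (X (Sum.inl i) - X (Sum.inl (i - 1))) ^ 3))) ((MvPolynomial.mkDerivation ℝ (Sum.elim (fun i : ℤ => (X (Sum.inr i) : MvPolynomial (ℤ ⊕ ℤ) ℝ)) (fun i : ℤ => -(C (ω₂ + 2) * X (Sum.inl i)) + X (Sum.inl (i + 1)) + X (Sum.inl (i - 1))))) (homogeneousComponent 1 u)) + ((C (3 * lam) * X (Sum.inl 0) ^ 2 + C (3 * β) * (X (Sum.inl 1) - X (Sum.inl 0)) ^ 2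 + C (3 * β) * (X (Sum.inl 0) - X (Sum.inl (-1))) ^ 2) * (homogeneousComponent 1 u) - C (3 * β) * (X (Sum.inl 1) - X (Sum.inl 0)) ^ 2 * rename (Sum.map (fun i : ℤ => i + 1) (fun i : ℤ => i + 1)) (homogeneousComponent 1 u) - C (3 * β) * (X (Sum.inl 0) - X (Sum.inl (-1))) ^ 2 * rename (Sum.map (fun i : ℤ => i + -1) (fun i : ℤ => i + -1)) (homogeneousComponent 1 u))) = 0) := by
  classical
  -- bundle the three pieces as linear maps
  let L1 : MvPolynomial (ℤ ⊕ ℤ) ℝ →ₗ[ℝ] MvPolynomial (ℤ ⊕ ℤ) ℝ := (MvPolynomial.mkDerivation ℝ (Sum.elim (fun i : ℤ => (X (Sum.inr i) : MvPolynomial (ℤ ⊕ ℤ) ℝ)) (fun i : ℤ => -(C (ω₂ + 2) * X (Sum.inl i)) + X (Sum.inl (i + 1)) + X (Sum.inl (i - 1)))))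
  let L3 : MvPolynomial (ℤ ⊕ ℤ) ℝ →ₗ[ℝ] MvPolynomial (ℤ ⊕ ℤ) ℝ := (MvPolynomial.mkDerivation ℝ (Sum.elim (fun _ : ℤ => (0 : MvPolynomial (ℤ ⊕ ℤ) ℝ)) (fun i : ℤ => -(C lam * X (Sum.inl i) ^ 3) + C β * (X (Sum.inl (i + 1)) - X (Sum.inl i)) ^ 3 - C β * (X (Sum.inl i) - X (Sum.inl (i - 1))) ^ 3)))
  let S1 : MvPolynomial (ℤ ⊕ ℤ) ℝ →ₗ[ℝ] MvPolynomial (ℤ ⊕ ℤ) ℝ :=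
    (rename (Sum.map (fun i : ℤ => i + 1) (fun i : ℤ => i + 1))).toLinearMap
  let Sm1 : MvPolynomial (ℤ ⊕ ℤ) ℝ →ₗ[ℝ] MvPolynomial (ℤ ⊕ ℤ) ℝ :=
    (rename (Sum.map (fun i : ℤ => i + -1) (fun i : ℤ => i + -1))).toLinearMap
  let T₀ : MvPolynomial (ℤ ⊕ ℤ) ℝ →ₗ[ℝ] MvPolynomial (ℤ ⊕ ℤ) ℝ :=
    L1 ∘ₗ L1 + (LinearMap.mulLeft ℝ (C (ω₂ + 2)) - S1 - Sm1)
  let T₂ : MvPolynomial (ℤ ⊕ ℤ) ℝ →ₗ[ℝ] MvPolynomial (ℤ ⊕ ℤ) ℝ :=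
    L1 ∘ₗ L3 + L3 ∘ₗ L1 + (LinearMap.mulLeft ℝ (C (3 * lam) * X (Sum.inl 0) ^ 2 + C (3 * β) * (X (Sum.inl 1) - X (Sum.inl 0)) ^ 2 + C (3 * β) * (X (Sum.inl 0) - X (Sum.inl (-1))) ^ 2)
      - LinearMap.mulLeft ℝ (C (3 * β) * (X (Sum.inl 1) - X (Sum.inl 0)) ^ 2) ∘ₗ S1
      - LinearMap.mulLeft ℝ (C (3 * β) * (X (Sum.inl 0) - X (Sum.inl (-1))) ^ 2) ∘ₗ Sm1)
  let T₄ : MvPolynomial (ℤ ⊕ ℤ) ℝ →ₗ[ℝ] MvPolynomial (ℤ ⊕ ℤ) ℝ := L3 ∘ₗ L3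
  have hT₀ : ∀ f, T₀ f = (MvPolynomial.mkDerivation ℝ (Sum.elim (fun i : ℤ => (X (Sum.inr i) : MvPolynomial (ℤ ⊕ ℤ) ℝ)) (fun i : ℤ => -(C (ω₂ + 2) * X (Sum.inl i)) + X (Sum.inl (i + 1)) + X (Sum.inl (i - 1))))) ((MvPolynomial.mkDerivation ℝ (Sum.elim (fun i : ℤ => (X (Sum.inr i) : MvPolynomial (ℤ ⊕ ℤ) ℝ)) (fun i : ℤ => -(C (ω₂ + 2) * X (Sum.inl i)) + X (Sum.inl (i + 1)) + X (Sum.inl (i - 1))))) (f)) + (C (ω₂ + 2) * (f) - rename (Sum.map (fun i : ℤ => i + 1) (fun i : ℤ => i + 1)) (f) - rename (Sum.map (fun i : ℤ => i + -1) (fun i : ℤ => i + -1)) (f)) := fun f => rfl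
  have hT₂ : ∀ f, T₂ f = (MvPolynomial.mkDerivation ℝ (Sum.elim (fun i : ℤ => (X (Sum.inr i) : MvPolynomial (ℤ ⊕ ℤ) ℝ)) (fun i : ℤ => -(C (ω₂ + 2) * X (Sum.inl i)) + X (Sum.inl (i + 1)) + X (Sum.inl (i - 1))))) ((MvPolynomial.mkDerivation ℝ (Sum.elim (fun _ : ℤ => (0 : MvPolynomial (ℤ ⊕ ℤ) ℝ)) (fun i : ℤ => -(C lam * X (Sum.inl i) ^ 3) + C β * (X (Sum.inl (i + 1)) - X (Sum.inl i)) ^ 3 - C β * (X (Sum.inl i) - X (Sum.inl (i - 1))) ^ 3))) (f)) + (MvPolynomial.mkDerivation ℝ (Sum.elim (fun _ : ℤ => (0 : MvPolynomial (ℤ ⊕ ℤ) ℝ)) (fun i : ℤ => -(C lam * X (Sum.inl i) ^ 3) + C β * (X (Sum.inl (i + 1)) - X (Sum.inl i)) ^ 3 - C β * (X (Sum.inl i) - X (Sum.inl (i - 1))) ^ 3))) ((MvPolynomial.mkDerivation ℝ (Sum.elim (fun i : ℤ => (X (Sum.inr i) : MvPolynomial (ℤ ⊕ ℤ) ℝ))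 (fun i : ℤ => -(C (ω₂ + 2) * X (Sum.inl i)) + X (Sum.inl (i + 1)) + X (Sum.inl (i - 1))))) (f)) + ((C (3 * lam) * X (Sum.inl 0) ^ 2 + C (3 * β) * (X (Sum.inl 1) - X (Sum.inl 0)) ^ 2 + C (3 * β) * (X (Sum.inl 0) - X (Sum.inl (-1))) ^ 2) * (f) - C (3 * β) * (X (Sum.inl 1) - X (Sum.inl 0)) ^ 2 * rename (Sum.map (fun i : ℤ => i + 1) (fun i : ℤ => i + 1)) (f) - C (3 * β) * (X (Sum.inl 0) - X (Sum.inl (-1))) ^ 2 * rename (Sum.map (fun i : ℤ => i + -1) (fun i : ℤ => i + -1)) (f)) := fun f => rfl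
  have hT₄ : ∀ f, T₄ f = (MvPolynomial.mkDerivation ℝ (Sum.elim (fun _ : ℤ => (0 : MvPolynomial (ℤ ⊕ ℤ) ℝ)) (fun i : ℤ => -(C lam * X (Sum.inl i) ^ 3) + C β * (X (Sum.inl (i + 1)) - X (Sum.inl i)) ^ 3 - C β * (X (Sum.inl i) - X (Sum.inl (i - 1))) ^ 3))) ((MvPolynomial.mkDerivation ℝ (Sum.elim (fun _ : ℤ => (0 : MvPolynomial (ℤ ⊕ ℤ) ℝ)) (fun i : ℤ => -(C lam * X (Sum.inl i) ^ 3) + C β * (X (Sum.inl (i + 1)) - X (Sum.inl i)) ^ 3 - C β * (X (Sum.inl i) - X (Sum.inl (i - 1))) ^ 3))) (f)) := fun f => rfl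
  -- homogeneity of the pieces
  have h₀ : ∀ (n : ℕ) (f : MvPolynomial (ℤ ⊕ ℤ) ℝ), f.IsHomogeneous n → (T₀.toAddMonoidHom f).IsHomogeneous n := by
    intro n f hf
    show (T₀ f).IsHomogeneous n
    rw [hT₀]
    exact (isHomogeneous_liouville1 _ (isHomogeneous_liouville1 _ hf)).add
      (((hf.C_mul _).sub (isHomogeneous_shift 1 hf)).sub (isHomogeneous_shift (-1) hf))
  have h₂ : ∀ (n : ℕ) (f : MvPolynomial (ℤ ⊕ ℤ) ℝ), f.IsHomogeneous n → (T₂.toAddMonoidHom f).IsHomogeneous (n + 2) := by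
    intro n f hf
    show (T₂ f).IsHomogeneous (n + 2)
    rw [hT₂]
    obtain ⟨hw0, hw1, hwm1⟩ := isHomogeneous_stiffness (R := ℝ) lam β
    refine ((isHomogeneous_liouville1 _ (isHomogeneous_liouville3 _ _ hf)).add
      (isHomogeneous_liouville3 _ _ (isHomogeneous_liouville1 _ hf))).add ?_
    rw [show n + 2 = 2 + n from add_comm _ _]
    exact ((hw0.mul hf).sub (hw1.mul (isHomogeneous_shift 1 hf))).sub (hwm1.mul (isHomogeneous_shift (-1) hf))
  have h₄ : ∀ (n : ℕ) (f : MvPolynomial (ℤ ⊕ ℤ) ℝ), f.IsHomogeneous n → (T₄.toAddMonoidHom f).IsHomogeneous (n + 4) := by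
    intro n f hf
    show (T₄ f).IsHomogeneous (n + 4)
    rw [hT₄]
    exact isHomogeneous_liouville3 _ _ (isHomogeneous_liouville3 _ _ hf)
  have hsplit' : T₀.toAddMonoidHom u + T₂.toAddMonoidHom u + T₄.toAddMonoidHom u = 0 := by exact hsplit
  have hce := component_extraction T₀.toAddMonoidHom T₂.toAddMonoidHom T₄.toAddMonoidHom h₀ h₂ h₄ u hsplit'
  constructor
  · have := hce n₀
    rw [Finset.sum_eq_zero fun n _ => ?_, Finset.sum_eq_zero fun n _ => ?_, add_zero, add_zero] at this
    · exact this
    · split_ifs with h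
      · rw [hmin n (by omega), map_zero]
      · rfl
    · split_ifs with h
      · rw [hmin n (by omega), map_zero]
      · rfl
  · intro hn₀
    have := hce 3
    rw [Finset.sum_eq_single 1, if_pos rfl, Finset.sum_eq_zero fun n _ => ?_, add_zero] at this
    · exact this
    · rw [if_neg (by omega)]
    · intro n _ hn
      rw [if_neg (by omega)]
    · intro h1
      rw [Finset.mem_range, not_lt] at h1
      rw [if_pos rfl, homogeneousComponent_eq_zero _ _ (by omega), map_zero]



/-- **Case `n₀ = 0`.** A constant solution of `T₀ w = 0` vanishes when `ω₂ ≠ 0`. -/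
theorem case_degree_zero (ω₂ : ℝ) (hω : ω₂ ≠ 0) (u : MvPolynomial (ℤ ⊕ ℤ) ℝ)
    (h : ((MvPolynomial.mkDerivation ℝ (Sum.elim (fun i : ℤ => (X (Sum.inr i) : MvPolynomial (ℤ ⊕ ℤ) ℝ)) (fun i : ℤ => -(C (ω₂ + 2) * X (Sum.inl i)) + X (Sum.inl (i + 1)) + X (Sum.inl (i - 1))))) ((MvPolynomial.mkDerivation ℝ (Sum.elim (fun i : ℤ => (X (Sum.inr i) : MvPolynomial (ℤ ⊕ ℤ) ℝ)) (fun i : ℤ => -(C (ω₂ + 2) * X (Sum.inl i)) + X (Sum.inl (i + 1)) + X (Sum.inl (i - 1))))) (homogeneousComponent 0 u)) + (C (ω₂ + 2) * (homogeneousComponent 0 u) - rename (Sum.map (fun i : ℤ => i + 1) (fun i : ℤ => i + 1)) (homogeneousComponent 0 u) - rename (Sum.map (fun i : ℤ => i + -1) (fun i : ℤ => i + -1)) (homogeneousComponent 0 u))) = 0) : homogeneousComponent 0 u = 0 := by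
  rw [homogeneousComponent_zero] at h ⊢
  rw [derivation_C, map_zero, rename_C, rename_C, zero_add, ← map_mul, ← map_sub, ← map_sub, C_eq_zero] at h
  have : ω₂ * coeff 0 u = 0 := by linear_combination h
  rw [(mul_eq_zero.mp this).resolve_left hω, map_zero]

/-- **Case `n₀ ≥ 2`** (harmonic rigidity, stubs C + D). A homogeneous real solution of degree `n ≥ 2` of the
harmonic linearised equation `T₀ w = 0` vanishes. -/
theorem case_degree_high
    (hC : ∀ (ω₂ : ℝ) (n : ℕ) (w : MvPolynomial (ℤ ⊕ ℤ) ℂ), w.totalDegree ≤ n →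
    ∀ P : Fin n → ℂ × ℂ, (∀ j, (P j).1 ≠ 0 ∧ (P j).2 ^ 2 = -((ω₂ : ℂ) + 2 - (P j).1 - ((P j).1)⁻¹)) →
      MvPolynomial.constantCoeff ((List.ofFn P).foldr (fun (Pj : ℂ × ℂ) (acc : MvPolynomial (ℤ ⊕ ℤ) ℂ) => MvPolynomial.mkDerivation ℂ (Sum.elim (fun x : ℤ => (MvPolynomial.C (Pj.1 ^ x) : MvPolynomial (ℤ ⊕ ℤ) ℂ)) (fun x : ℤ => MvPolynomial.C (Pj.2 * Pj.1 ^ x))) acc) ((MvPolynomial.mkDerivation ℂ (Sum.elim (fun i : ℤ => (MvPolynomial.X (Sum.inr i) : MvPolynomial (ℤ ⊕ ℤ) ℂ)) (fun i : ℤ => -(MvPolynomial.C ((ω₂ : ℂ) + 2) * MvPolynomial.X (Sum.inl i)) + MvPolynomial.X (Sum.inl (i + 1)) + MvPolynomial.X (Sum.inl (i - 1))))) ((MvPolynomial.mkDerivation ℂ (Sum.elim (fun i : ℤ => (MvPolynomial.X (Sum.inr i) : MvPolynomial (ℤ ⊕ ℤ) ℂ)) (fun i : ℤ => -(MvPolynomial.C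 ((ω₂ : ℂ) + 2) * MvPolynomial.X (Sum.inl i)) + MvPolynomial.X (Sum.inl (i + 1)) + MvPolynomial.X (Sum.inl (i - 1))))) (w)) + (MvPolynomial.C ((ω₂ : ℂ) + 2) * (w) - MvPolynomial.rename (Sum.map (fun i : ℤ => i + 1) (fun i : ℤ => i + 1)) (w) - MvPolynomial.rename (Sum.map (fun i : ℤ => i - 1) (fun i : ℤ => i - 1)) (w)))) =
        ((∑ j, (P j).2) ^ 2 + ((ω₂ : ℂ) + 2 - (∏ j, (P j).1) - (∏ j, (P j).1)⁻¹)) * MvPolynomial.constantCoeff ((List.ofFn P).foldr (fun (Pj : ℂ × ℂ) (acc : MvPolynomial (ℤ ⊕ ℤ) ℂ) => MvPolynomial.mkDerivation ℂ (Sum.elim (fun x : ℤ => (MvPolynomial.C (Pj.1 ^ x) : MvPolynomial (ℤ ⊕ ℤ) ℂ)) (fun x : ℤ => MvPolynomial.C (Pj.2 * Pj.1 ^ x))) acc) (w)))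
    (hD : ∀ (ω₂ : ℝ), ω₂ ≠ 0 → ∀ (n : ℕ), 2 ≤ n → ∀ (w : MvPolynomial (ℤ ⊕ ℤ) ℂ), w.IsHomogeneous n →
      (∀ P : Fin n → ℂ × ℂ, (∀ j, (P j).1 ≠ 0 ∧ (P j).2 ^ 2 = -((ω₂ : ℂ) + 2 - (P j).1 - ((P j).1)⁻¹)) →
        ((∑ j, (P j).2) ^ 2 + ((ω₂ : ℂ) + 2 - (∏ j, (P j).1) - (∏ j, (P j).1)⁻¹)) * MvPolynomial.constantCoeff ((List.ofFn P).foldr (fun (Pj : ℂ × ℂ) (acc : MvPolynomial (ℤ ⊕ ℤ) ℂ) => MvPolynomial.mkDerivation ℂ (Sum.elim (fun x : ℤ => (MvPolynomial.C (Pj.1 ^ x) : MvPolynomial (ℤ ⊕ ℤ) ℂ)) (fun x : ℤ => MvPolynomial.C (Pj.2 * Pj.1 ^ x))) acc) (w)) = 0) →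
      w = 0)
    (ω₂ : ℝ) (hω : ω₂ ≠ 0) (n : ℕ) (hn : 2 ≤ n) (w : MvPolynomial (ℤ ⊕ ℤ) ℝ) (hw : w.IsHomogeneous n)
    (h : ((MvPolynomial.mkDerivation ℝ (Sum.elim (fun i : ℤ => (X (Sum.inr i) : MvPolynomial (ℤ ⊕ ℤ) ℝ)) (fun i : ℤ => -(C (ω₂ + 2) * X (Sum.inl i)) + X (Sum.inl (i + 1)) + X (Sum.inl (i - 1))))) ((MvPolynomial.mkDerivation ℝ (Sum.elim (fun i : ℤ => (X (Sum.inr i) : MvPolynomial (ℤ ⊕ ℤ) ℝ)) (fun i : ℤ => -(C (ω₂ + 2) * X (Sum.inl i)) + X (Sum.inl (i + 1)) + X (Sum.inl (i - 1))))) (w)) + (C (ω₂ + 2) * (w) - rename (Sum.map (fun i : ℤ => i + 1) (fun i : ℤ => i + 1)) (w) - rename (Sum.map (fun i : ℤ => i + -1) (fun i : ℤ => i + -1)) (w))) = 0) : w = 0 := by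
  -- base change to `ℂ`
  set wc : MvPolynomial (ℤ ⊕ ℤ) ℂ := MvPolynomial.map Complex.ofRealHom w with hwc
  have hwch : wc.IsHomogeneous n := hw.map _
  have hD0 : (MvPolynomial.mkDerivation ℂ (Sum.elim (fun i : ℤ => (MvPolynomial.X (Sum.inr i) : MvPolynomial (ℤ ⊕ ℤ) ℂ)) (fun i : ℤ => -(MvPolynomial.C ((ω₂ : ℂ) + 2) * MvPolynomial.X (Sum.inl i)) + MvPolynomial.X (Sum.inl (i + 1)) + MvPolynomial.X (Sum.inl (i - 1))))) ((MvPolynomial.mkDerivation ℂ (Sum.elim (fun i : ℤ => (MvPolynomial.X (Sum.inr i) : MvPolynomial (ℤ ⊕ ℤ) ℂ)) (fun i : ℤ => -(MvPolynomial.C ((ω₂ : ℂ) + 2) * MvPolynomial.X (Sum.inl i)) + MvPolynomial.X (Sum.inl (i + 1)) + MvPolynomial.X (Sum.inl (i - 1))))) (wc)) + (MvPolynomial.C ((ω₂ : ℂ) + 2) * (wc) - MvPolynomial.rename (Sum.map (fun i : ℤ => i + 1) (fun i : ℤ => i + 1)) (wc) - MvPolynomial.rename (Sum.map (fun i : ℤ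 => i - 1) (fun i : ℤ => i - 1)) (wc)) = 0 := by
    have := congrArg (MvPolynomial.map Complex.ofRealHom) h
    simp only [map_add (MvPolynomial.map Complex.ofRealHom), map_sub (MvPolynomial.map Complex.ofRealHom),
      map_mul (MvPolynomial.map Complex.ofRealHom), mapC_liouville1, map_rename, map_C, map_zero,
      Complex.ofRealHom_eq_coe, Complex.ofReal_add, Complex.ofReal_ofNat] at this
    exact this
  have key : ∀ P : Fin n → ℂ × ℂ, (∀ j, (P j).1 ≠ 0 ∧ (P j).2 ^ 2 = -((ω₂ : ℂ) + 2 - (P j).1 - ((P j).1)⁻¹)) →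
      ((∑ j, (P j).2) ^ 2 + ((ω₂ : ℂ) + 2 - (∏ j, (P j).1) - (∏ j, (P j).1)⁻¹)) *
        MvPolynomial.constantCoeff ((List.ofFn P).foldr (fun (Pj : ℂ × ℂ) (acc : MvPolynomial (ℤ ⊕ ℤ) ℂ) =>
          MvPolynomial.mkDerivation ℂ (Sum.elim (fun x : ℤ => (MvPolynomial.C (Pj.1 ^ x) : MvPolynomial (ℤ ⊕ ℤ) ℂ))
            (fun x : ℤ => MvPolynomial.C (Pj.2 * Pj.1 ^ x))) acc) (wc)) = 0 := by
    intro P hP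
    have := hC ω₂ n wc hwch.totalDegree_le P hP
    rw [hD0, foldr_planeWave_zero, map_zero] at this
    exact this.symm
  have hwc0 : wc = 0 := hD ω₂ hω n hn wc hwch key
  exact MvPolynomial.map_injective _ Complex.ofReal_injective (by rw [← hwc, hwc0, map_zero])


/-- ANCHOR of this helper file (registered sub-goal of the crux): the degree-zero case of the rigidity
theorem. -/
theorem mainReduction_case_degree_zero_anchor :
    ∀ (ω₂ : ℝ), ω₂ ≠ 0 → ∀ u : MvPolynomial (ℤ ⊕ ℤ) ℝ, (MvPolynomial.mkDerivation ℝ (Sum.elim (fun i : ℤ => (MvPolynomial.X (Sum.inr i) : MvPolynomial (ℤ ⊕ ℤ) ℝ)) (fun i : ℤ => -(MvPolynomial.C (ω₂ + 2) * MvPolynomial.X (Sum.inl i)) + MvPolynomial.X (Sum.inl (i + 1)) + MvPolynomial.X (Sum.inl (i - 1))))) ((MvPolynomial.mkDerivation ℝ (Sum.elim (fun i : ℤ => (MvPolynomial.X (Sum.inr i) : MvPolynomial (ℤ ⊕ ℤ) ℝ)) (fun i : ℤ => -(MvPolynomial.C (ω₂ + 2) * MvPolynomial.X (Sum.inl i))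 + MvPolynomial.X (Sum.inl (i + 1)) + MvPolynomial.X (Sum.inl (i - 1))))) (MvPolynomial.homogeneousComponent 0 u)) + (MvPolynomial.C (ω₂ + 2) * (MvPolynomial.homogeneousComponent 0 u) - MvPolynomial.rename (Sum.map (fun i : ℤ => i + 1) (fun i : ℤ => i + 1)) (MvPolynomial.homogeneousComponent 0 u) - MvPolynomial.rename (Sum.map (fun i : ℤ => i + -1) (fun i : ℤ => i + -1)) (MvPolynomial.homogeneousComponent 0 u)) = 0 → MvPolynomial.homogeneousComponent 0 u = 0 :=
  fun ω₂ hω u h => case_degree_zero ω₂ hω u h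

end Summit.AtomisticToContinuum.FouriersLaw.Theorems.DressedCharge

end
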